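/-
Origin: expansion seat `planner-pub-hodgecm-pv09-g4-0`, handover #11 2026-08-18T08:07:20Z (`HOME/pub-hodgecm-pv09-g4/lean/Pv09g4/RestrictedCutout.lean`, md5 256db4bc, 221 lines);
landed by the gen-7 packager in gate run 26 as `HodgeCM/PerL34/RestrictedCutout.lean` (import ^import Pv[0-9]+g[0-9]+\.→import HodgeCM.PerL34. ×1).
-/
/-
HodgeCM / PerL34 publication cell — seam S3 set-up, model side (pub-hodgecm-pv09-g4, HANDOVER #11).
WIP imports: `Pv09g4.RestrictedUnits` ↦ `HodgeCM.PerL34.RestrictedUnits` at landing; otherwise Mathlib.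
Complete proofs, no new axioms, nothing cited.
-/
import Summits.HodgeConjecture.HodgeCM.PerL34.RestrictedUnits
import Mathlib.Algebra.Group.Subgroup.Map

/-!
# Cutting closed subgroups out of a restricted product, fibrewise

For topological groups `G k` (`k : κ`) with open subgroups `B k` and ANY subgroups `H k ≤ G k`, the
subgroup of the restricted product cut out by the coordinatewise conditions `y_k ∈ H_k`,

  `cutout B H = {y ∈ Πʳ k, [G k, B k] | ∀ k, y k ∈ H k}`   (subspace topology from `Πʳ k, [G k, B k]`),

IS the restricted product of the `H k` with respect to the open subgroups `B k ⊓ H k ≤ H k`, as a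
topological group:

  `cutoutEquiv B H : (Πʳ k, [H k, (B k).subgroupOf (H k)]) ≃ₜ* cutout B H`.

Continuity of the forward map is Mathlib's `RestrictedProduct.mapAlong_continuous` (coordinatewise
inclusions); continuity of the inverse is tested on the open subgroup `Π k, (B k ⊓ H k) ↪ cutout B H`
(`RestrictedUnits.continuous_of_isOpenMap_comp`), on which it is the structure map of the target.

(Use in seam S3, GAPS pv09g4-A5: after `RestrictedUnits.ideleGroupEquiv` and `RestrictedRegroup.regroupEquiv`
the idelic norm-one torus `{y ∈ 𝔸_Lˣ | y · σy = 1}` of pv11-g4 is `cutout` of the fibrewise local norm-one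
groups `H_v ≤ Π_{w ∣ v} L_wˣ`, hence a restricted product `Πʳ_v [H_v, H_v ∩ Π 𝒪_wˣ]` of LOCAL groups — the
index/group shape in which the S3 end-form `RallisHeadline` is stated.)
-/

set_option autoImplicit false

noncomputable section

open Topology Filter Set
open scoped RestrictedProduct

namespace HodgeCM.PerL34.RestrictedCutout

variable {κ : Type*} {G : κ → Type*} [∀ k, Group (G k)] (B H : ∀ k, Subgroup (G k))

/-- The subgroup of `Πʳ k, [G k, B k]` cut out by `y k ∈ H k` for all `k`. -/
def cutout : Subgroup (Πʳ k, [G k, B k]) where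
  carrier := {y | ∀ k, y k ∈ H k}
  one_mem' := fun k => (H k).one_mem
  mul_mem' := fun hy hz k => (H k).mul_mem (hy k) (hz k)
  inv_mem' := fun hy k => (H k).inv_mem (hy k)

/-- (Ported verbatim from the HodgeCMPerL package; no docstring in the source.) -/
theorem mem_cutout_iff {y : Πʳ k, [G k, B k]} : y ∈ cutout B H ↔ ∀ k, y k ∈ H k := Iff.rfl

/-- `B k ⊓ H k` as a subgroup of `H k`. -/
abbrev inH (k : κ) : Subgroup (H k) := (B k).subgroupOf (H k)

/-! ## The two maps -/

/-- `Πʳ k, [H k, B k ⊓ H k] → cutout B H`, coordinatewise inclusion. -/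
def toCutout (y : Πʳ k, [H k, inH B H k]) : cutout B H :=
  ⟨⟨fun k => ((y k : H k) : G k), by
      filter_upwards [y.2] with k hk
      exact Subgroup.mem_subgroupOf.mp hk⟩,
    fun k => (y k).2⟩

/-- (Ported verbatim from the HodgeCMPerL package; no docstring in the source.) -/
@[simp] theorem coe_toCutout_apply (y : Πʳ k, [H k, inH B H k]) (k : κ) :
    ((toCutout B H y : cutout B H) : Πʳ k, [G k, B k]) k = ((y k : H k) : G k) := rfl

/-- `cutout B H → Πʳ k, [H k, B k ⊓ H k]`. -/
def ofCutout (y : cutout B H) : Πʳ k, [H k, inH B H k] :=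
  ⟨fun k => ⟨(y : Πʳ k, [G k, B k]) k, y.2 k⟩, by
      filter_upwards [(y : Πʳ k, [G k, B k]).2] with k hk
      exact Subgroup.mem_subgroupOf.mpr hk⟩

/-- (Ported verbatim from the HodgeCMPerL package; no docstring in the source.) -/
@[simp] theorem coe_ofCutout_apply (y : cutout B H) (k : κ) :
    ((ofCutout B H y k : H k) : G k) = (y : Πʳ k, [G k, B k]) k := rfl

/-- (Ported verbatim from the HodgeCMPerL package; no docstring in the source.) -/
theorem ofCutout_toCutout (y : Πʳ k, [H k, inH B H k]) : ofCutout B H (toCutout B H y) = y := by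
  ext k; rfl

/-- (Ported verbatim from the HodgeCMPerL package; no docstring in the source.) -/
theorem toCutout_ofCutout (y : cutout B H) : toCutout B H (ofCutout B H y) = y := by
  apply Subtype.ext; ext k; rfl

/-- (Ported verbatim from the HodgeCMPerL package; no docstring in the source.) -/
theorem toCutout_mul (y z : Πʳ k, [H k, inH B H k]) :
    toCutout B H (y * z) = toCutout B H y * toCutout B H z := by
  apply Subtype.ext; ext k; rfl

/-! ## Topology -/

section topology

variable [∀ k, TopologicalSpace (G k)]

/-- `B k ⊓ H k` is open in `H k` when `B k` is open in `G k`. -/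
theorem isOpen_inH (hBo : ∀ k, IsOpen (B k : Set (G k))) (k : κ) :
    IsOpen (inH B H k : Set (H k)) := by
  have h : (inH B H k : Set (H k)) = ((↑) : H k → G k) ⁻¹' (B k : Set (G k)) := by
    ext x; simp [Subgroup.mem_subgroupOf]
  rw [h]
  exact (hBo k).preimage continuous_subtype_val

/-- (Ported verbatim from the HodgeCMPerL package; no docstring in the source.) -/
instance fact_isOpen_inH [hBo : Fact (∀ k, IsOpen (B k : Set (G k)))] :
    Fact (∀ k, IsOpen (inH B H k : Set (H k))) :=
  ⟨isOpen_inH B H hBo.out⟩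

/-- The forward map is continuous (no openness needed). -/
theorem continuous_toCutout : Continuous (toCutout B H) := by
  apply Continuous.subtype_mk
  have hφ : ∀ᶠ k in (cofinite : Filter κ),
      MapsTo ((↑) : H k → G k) (inH B H k : Set (H k)) (B k : Set (G k)) :=
    Eventually.of_forall fun k x hx => Subgroup.mem_subgroupOf.mp hx
  have h := RestrictedProduct.mapAlong_continuous (fun k => (H k : Type _)) G
    (A₁ := fun k => (inH B H k : Set (H k))) (A₂ := fun k => (B k : Set (G k)))
    (𝓕₁ := cofinite) (𝓕₂ := cofinite) id tendsto_id
    (fun k => ((↑) : H k → G k)) hφ (fun k => continuous_subtype_val)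
  exact h

variable [∀ k, IsTopologicalGroup (G k)] [hBo : Fact (∀ k, IsOpen (B k : Set (G k)))]

/-- The test map `Π k, (B k ⊓ H k) → cutout B H`. -/
def boxMap (x : Π k, inH B H k) : cutout B H :=
  ⟨⟨fun k => (((x k : inH B H k) : H k) : G k),
      Eventually.of_forall fun k => Subgroup.mem_subgroupOf.mp (x k).2⟩,
    fun k => ((x k : inH B H k) : H k).2⟩

omit [∀ k, IsTopologicalGroup (G k)] in
/-- `boxMap` is an open embedding: it is the structure map `Π k, B k ↪ Πʳ k, [G k, B k]` (an open embedding,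
Mathlib) composed with the embedding `Π k, (B k ⊓ H k) ↪ Π k, B k`, corestricted to `cutout B H`, and its
range `cutout B H ∩ (Π k, B k)` is open in `cutout B H`. -/
theorem isOpenEmbedding_boxMap : IsOpenEmbedding (boxMap B H) := by
  -- the embedding `Π k, (B k ⊓ H k) ↪ Π k, B k`
  let ψ₁ : ∀ k, inH B H k → B k := fun k x => ⟨((x : H k) : G k), Subgroup.mem_subgroupOf.mp x.2⟩
  have hψ₁ : ∀ k, IsEmbedding (ψ₁ k) := by
    intro k
    have hcomp : ((↑) : B k → G k) ∘ ψ₁ k = ((↑) : H k → G k) ∘ ((↑) : inH B H k → H k) := by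
      funext x; rfl
    have h2 : IsEmbedding (((↑) : H k → G k) ∘ ((↑) : inH B H k → H k)) :=
      IsEmbedding.subtypeVal.comp IsEmbedding.subtypeVal
    rw [← hcomp] at h2
    exact (IsEmbedding.of_comp_iff IsEmbedding.subtypeVal).mp h2
  have hψ : IsEmbedding (Pi.map ψ₁) := IsEmbedding.piMap hψ₁
  -- the composite with the structure map
  let e : (Π k, inH B H k) → Πʳ k, [G k, B k] :=
    RestrictedProduct.structureMap G (fun k => (B k : Set (G k))) cofinite ∘ Pi.map ψ₁
  have he : IsEmbedding e :=
    (RestrictedProduct.isOpenEmbedding_structureMap hBo.out).isEmbedding.comp hψ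
  have hmem : ∀ x, e x ∈ (cutout B H : Set (Πʳ k, [G k, B k])) :=
    fun x k => ((x k : inH B H k) : H k).2
  have hcod : IsEmbedding (codRestrict e (cutout B H : Set (Πʳ k, [G k, B k])) hmem) := he.codRestrict _ hmem
  have hbox : boxMap B H = codRestrict e (cutout B H : Set (Πʳ k, [G k, B k])) hmem := by
    funext x
    apply Subtype.ext
    ext k
    rfl
  refine ⟨hbox ▸ hcod, ?_⟩
  -- the range is `cutout ∩ range (structureMap)`, open in the subspace topology
  have hrange : range (boxMap B H) =
      ((↑) : cutout B H → Πʳ k, [G k, B k]) ⁻¹'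
        range (RestrictedProduct.structureMap G (fun k => (B k : Set (G k))) cofinite) := by
    ext y
    constructor
    · rintro ⟨x, rfl⟩
      exact ⟨Pi.map ψ₁ x, rfl⟩
    · rintro ⟨x, hx⟩
      have hxH : ∀ k, (x k : G k) ∈ H k := by
        intro k
        have h1 : (x k : G k) = (y : Πʳ k, [G k, B k]) k := by
          rw [← hx]; rfl
        rw [h1]
        exact y.2 k
      refine ⟨fun k => ⟨⟨(x k : G k), hxH k⟩, Subgroup.mem_subgroupOf.mpr (x k).2⟩, ?_⟩
      apply Subtype.ext
      rw [← hx]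
      rfl
  rw [hrange]
  exact (RestrictedProduct.isOpenEmbedding_structureMap hBo.out).isOpen_range.preimage
    continuous_subtype_val

/-- The inverse map as a group homomorphism. -/
def ofCutoutMonoidHom : cutout B H →* Πʳ k, [H k, inH B H k] where
  toFun := ofCutout B H
  map_one' := by ext k; rfl
  map_mul' y z := by ext k; rfl

/-- The inverse map is continuous: on the open subgroup `Π k, (B k ⊓ H k)` it is the structure map of
the target. -/
theorem continuous_ofCutout : Continuous (ofCutout B H) := by
  have h1 : boxMap B H 1 = 1 := by
    apply Subtype.ext; ext k; rfl
  have hc : Continuous (ofCutoutMonoidHom B H ∘ boxMap B H) := by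
    have hfac : (ofCutoutMonoidHom B H ∘ boxMap B H : (Π k, inH B H k) → Πʳ k, [H k, inH B H k]) =
        RestrictedProduct.structureMap (fun k => (H k : Type _)) (fun k => (inH B H k : Set (H k)))
          cofinite := by
      funext x
      ext k
      rfl
    rw [hfac]
    exact RestrictedProduct.isEmbedding_structureMap.continuous
  exact RestrictedUnits.continuous_of_isOpenMap_comp (ofCutoutMonoidHom B H) (boxMap B H)
    (isOpenEmbedding_boxMap B H).isOpenMap h1 hc.continuousAt

/-- **A fibrewise cut-out of a restricted product is the restricted product of the fibres**, as
topological groups. -/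
def cutoutEquiv : (Πʳ k, [H k, inH B H k]) ≃ₜ* cutout B H where
  toFun := toCutout B H
  invFun := ofCutout B H
  left_inv := ofCutout_toCutout B H
  right_inv := toCutout_ofCutout B H
  map_mul' := toCutout_mul B H
  continuous_toFun := continuous_toCutout B H
  continuous_invFun := continuous_ofCutout B H

/-- (Ported verbatim from the HodgeCMPerL package; no docstring in the source.) -/
@[simp] theorem coe_cutoutEquiv_apply (y : Πʳ k, [H k, inH B H k]) (k : κ) :
    ((cutoutEquiv B H y : cutout B H) : Πʳ k, [G k, B k]) k = ((y k : H k) : G k) := rfl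

/-- (Ported verbatim from the HodgeCMPerL package; no docstring in the source.) -/
@[simp] theorem coe_cutoutEquiv_symm_apply (y : cutout B H) (k : κ) :
    (((cutoutEquiv B H).symm y k : H k) : G k) = (y : Πʳ k, [G k, B k]) k := rfl

end topology

end HodgeCM.PerL34.RestrictedCutout

end
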